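import Mathlib
import Summits.CriticalPhenomena.PercolationContinuityZ3.Theorems.PinholeClosing.Negative.PinholeClosingBaseline
import HarnessLib

/-!
# Crux `PercBudgetLadder.PinholeClosing` (stmt-CriticalPhenomena-5249), lines `balanced-deletion` / `pocket-resampling` — stub `stub_cauchySchwarz`

Helper file for the crux skeletons `Cruxes/PinholeClosing/Lines/balanced_deletion.lean` and
`Cruxes/PinholeClosing/Lines/pocket_resampling.lean` (lead prover-line-stmt-CriticalPhenomena-5249-c1-0); proves
exactly the registered stub `stub_cauchySchwarz` of those skeletons (the SAME registered statement serves both,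
`--supports stmt-CriticalPhenomena-5249`), one namespace down as
`Summit.CriticalPhenomena.PercolationContinuityZ3.Theorems.BalancedDeletion.stub_cauchySchwarz`.  No new
definitions: the statement is in the tree's vocabulary (`bondPercolation (zdGraph 3) (criticalProbI 3)`,
`BondConfig`, `Measure.real`).

Informal statement (CAUCHY–SCHWARZ AGAINST AN EVENT).  Write `P = bondPercolation (zdGraph 3) (criticalProbI 3)`.
For a measurable event `s` and a measurable `f` with `0 ≤ f ≤ C`:
`(∫_s f dP)² ≤ P(s) · ∫ f² dP`.

Proof route (the discriminant argument, generic over a finite measure `μ` and integrable `f`, `f²`: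
`CauchySchwarz.sq_setIntegral_le`).  For every real `t`,
`0 ≤ ∫ (t f − 𝟙_s)² dμ = (∫ f² dμ) t² − 2 (∫_s f dμ) t + μ(s)` (pointwise expansion
`(t f − 𝟙_s)² = t² f² − 2t 𝟙_s f + 𝟙_s`, linearity of the integral, `∫ 𝟙_s f = ∫_s f`, `∫ 𝟙_s = μ(s)`), so the
discriminant of this quadratic is nonpositive (`discrim_le_zero`): `4 (∫_s f)² − 4 (∫ f²) μ(s) ≤ 0`.
Integrability of `f` and `f²` under the probability measure `P` follows from the bounds `0 ≤ f ≤ C`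
(`Integrable.of_bound`).
-/

noncomputable section

namespace Summit.CriticalPhenomena.PercolationContinuityZ3.Theorems

open MeasureTheory
open Literature.Probability.Percolation Literature.Probability.LatticeModels
open Summit.CriticalPhenomena.PercolationContinuityZ3.Theorems.PinholeClosing.Negative

namespace BalancedDeletion

namespace CauchySchwarz

variable {Ω : Type*}

/-- Pointwise expansion `(t f − 𝟙_s)² = t² f² − 2t 𝟙_s f + 𝟙_s` (as `𝟙_s² = 𝟙_s`). [folklore] -/
theorem sq_sub_indicator_eq (f : Ω → ℝ) (s : Set Ω) (t : ℝ) (ω : Ω) :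
    (t * f ω - s.indicator 1 ω) ^ 2 =
      t * t * f ω ^ 2 - 2 * t * s.indicator f ω + s.indicator 1 ω := by
  by_cases h : ω ∈ s
  · rw [Set.indicator_of_mem h, Set.indicator_of_mem h, Pi.one_apply]
    ring
  · rw [Set.indicator_of_notMem h, Set.indicator_of_notMem h]
    ring

variable [MeasurableSpace Ω]

/-- `∫ (t f − 𝟙_s)² dμ = (∫ f² dμ) t² − 2 (∫_s f dμ) t + μ(s)` for a finite measure `μ`, a measurable `s` and
integrable `f`, `f²` (linearity of the Bochner integral). [folklore] -/
theorem integral_sq_sub_indicator (μ : Measure Ω) [IsFiniteMeasure μ] {f : Ω → ℝ} {s : Set Ω}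
    (hs : MeasurableSet s) (hfi : Integrable f μ) (hf2 : Integrable (fun ω => f ω ^ 2) μ) (t : ℝ) :
    ∫ ω, (t * f ω - s.indicator 1 ω) ^ 2 ∂μ =
      (∫ ω, f ω ^ 2 ∂μ) * (t * t) + (-2 * ∫ ω in s, f ω ∂μ) * t + μ.real s := by
  have h : ∫ ω, (t * f ω - s.indicator 1 ω) ^ 2 ∂μ =
      ∫ ω, (t * t * f ω ^ 2 - 2 * t * s.indicator f ω + s.indicator 1 ω) ∂μ :=
    integral_congr_ae (ae_of_all _ fun ω => sq_sub_indicator_eq f s t ω)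
  have h1 : Integrable (fun ω => t * t * f ω ^ 2) μ := hf2.const_mul _
  have h2 : Integrable (fun ω => 2 * t * s.indicator f ω) μ := (hfi.indicator hs).const_mul _
  have h12 : Integrable (fun ω => t * t * f ω ^ 2 - 2 * t * s.indicator f ω) μ := h1.sub h2
  have h3 : Integrable (fun ω => s.indicator (1 : Ω → ℝ) ω) μ := (integrable_const (1 : ℝ)).indicator hs
  rw [h, integral_add h12 h3, integral_sub h1 h2, integral_const_mul, integral_const_mul, integral_indicator hs,
    integral_indicator_one hs]
  ring

/-- **Cauchy–Schwarz against an indicator**: `(∫_s f dμ)² ≤ μ(s) · ∫ f² dμ` for a finite measure `μ`, a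
measurable `s` and integrable `f`, `f²` — the discriminant of the nonnegative quadratic
`t ↦ ∫ (t f − 𝟙_s)² dμ` is nonpositive (`discrim_le_zero`). [folklore] -/
theorem sq_setIntegral_le (μ : Measure Ω) [IsFiniteMeasure μ] {f : Ω → ℝ} {s : Set Ω}
    (hs : MeasurableSet s) (hfi : Integrable f μ) (hf2 : Integrable (fun ω => f ω ^ 2) μ) :
    (∫ ω in s, f ω ∂μ) ^ 2 ≤ μ.real s * ∫ ω, f ω ^ 2 ∂μ := by
  have hq : ∀ t : ℝ,
      0 ≤ (∫ ω, f ω ^ 2 ∂μ) * (t * t) + (-2 * ∫ ω in s, f ω ∂μ) * t + μ.real s := by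
    intro t
    rw [← integral_sq_sub_indicator μ hs hfi hf2 t]
    exact integral_nonneg fun ω => sq_nonneg _
  have hd := discrim_le_zero hq
  rw [discrim] at hd
  nlinarith [hd]

end CauchySchwarz

/-- **Cauchy–Schwarz for critical bond percolation on `ℤ³`** (lines `balanced-deletion` / `pocket-resampling`,
registered stub `stub_cauchySchwarz`, VERBATIM signature).  For a measurable event `s` and a measurable `f` with
`0 ≤ f ≤ C`, `(∫_s f dP)² ≤ P(s) · ∫ f² dP`, `P = bondPercolation (zdGraph 3) (criticalProbI 3)`: the generic
`CauchySchwarz.sq_setIntegral_le` (discriminant argument), integrability of `f` and `f²` under the probability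
measure `P` coming from the bounds `0 ≤ f ≤ C` (`Integrable.of_bound`). -/
theorem stub_cauchySchwarz :
    ∀ (f : BondConfig (Site 3) → ℝ) (s : Set (BondConfig (Site 3))) (C : ℝ),
      MeasurableSet s → Measurable f → (∀ ω, 0 ≤ f ω) → (∀ ω, f ω ≤ C) →
      (∫ ω in s, f ω ∂(bondPercolation (zdGraph 3) (criticalProbI 3))) ^ 2 ≤
        (bondPercolation (zdGraph 3) (criticalProbI 3)).real s *
          ∫ ω, f ω ^ 2 ∂(bondPercolation (zdGraph 3) (criticalProbI 3)) := by
  intro f s C hs hf h0 hC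
  refine CauchySchwarz.sq_setIntegral_le _ hs ?_ ?_
  · refine Integrable.of_bound hf.aestronglyMeasurable C (ae_of_all _ fun ω => ?_)
    rw [Real.norm_eq_abs, abs_of_nonneg (h0 ω)]
    exact hC ω
  · refine Integrable.of_bound (hf.pow_const 2).aestronglyMeasurable (C ^ 2) (ae_of_all _ fun ω => ?_)
    rw [Real.norm_eq_abs, abs_of_nonneg (sq_nonneg (f ω))]
    exact pow_le_pow_left₀ (h0 ω) (hC ω) 2

end BalancedDeletion

end Summit.CriticalPhenomena.PercolationContinuityZ3.Theorems

end
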